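import Mathlib.Analysis.SpecialFunctions.Log.Basic
import HarnessLib

/-!
# Non-resonant heights are cofinal (RH-free stub of crux `OddSector.OddOneSignedWindows`)

Stub `stub_nonResonantCofinal` of the line `SketchIdeator5` of crux item stmt-RiemannHypothesis-17778
(card `prolate-seed-sign-from-energy`): elementary real analysis (`Real.log` / `Real.exp` only).

For every `r > 0` and every height `B` there is a window `a ≥ B` with `r e^{-2a} ≤ |a − log n|`
for all integers `n ≥ 2`. Take `a := log (N + 1/2)` for a natural number `N ≥ max (4r + 2, e^B)`:
then `e^{-2a} = 1/(N + 1/2)²`; for `n ≤ N` one has `a − log n ≥ 1 − n/(N + 1/2) ≥ 1/(2N + 2)`,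
and for `n ≥ N + 1` one has `log n − a ≥ log (N + 1) − a ≥ 1 − (N + 1/2)/(N + 1) = 1/(2N + 2)`
(both from `log y − log x ≥ 1 − x/y`, i.e. `Real.one_sub_inv_le_log_of_pos` at `y/x`); finally
`r/(N + 1/2)² ≤ 1/(2N + 2)` because `N ≥ 4r + 2`.

Deliberately NOT here: the other stubs of the line and the composition `OddOneSignedWindows_of`
(they live in the line skeleton held by the lead).
-/

set_option linter.dupNamespace false

namespace Summit.RiemannHypothesis.RiemannHypothesis.Theorems.OddSector

/-- **Logarithmic increment bound.** For `0 < x` and `0 < y`, `(y − x)/y ≤ log y − log x`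
(the inequality `1 − t⁻¹ ≤ log t` at `t = y/x`). [folklore] -/
private theorem sub_div_le_log_sub_log {x y : ℝ} (hx : 0 < x) (hy : 0 < y) :
    (y - x) / y ≤ Real.log y - Real.log x := by
  have h := Real.one_sub_inv_le_log_of_pos (div_pos hy hx)
  rw [inv_div, Real.log_div hy.ne' hx.ne'] at h
  rwa [sub_div, div_self hy.ne']

/-- **Non-resonant heights are cofinal (RH-free, elementary).** For every `r > 0` and every
height `B` there is a window `a ≥ B` keeping distance `≥ r e^{-2a}` from every `log n`, `n ≥ 2`:
`a = log (N + 1/2)` for a natural number `N ≥ max (4r + 2, e^B)` works, the nearest `log n` being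
at distance `≥ 1/(2N + 2) ≥ r/(N + 1/2)² = r e^{-2a}`. [folklore] -/
theorem stub_nonResonantCofinal :
    ∀ r : ℝ, 0 < r → ∀ B : ℝ, ∃ a : ℝ, B ≤ a ∧
      ∀ n : ℕ, 2 ≤ n → r * Real.exp (-2 * a) ≤ |a - Real.log n| := by
  intro r hr B
  obtain ⟨N, hN⟩ := exists_nat_ge (max (4 * r + 2) (Real.exp B))
  have hNr : 4 * r + 2 ≤ (N : ℝ) := le_trans (le_max_left _ _) hN
  have hNB : Real.exp B ≤ (N : ℝ) := le_trans (le_max_right _ _) hN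
  have hM : (0 : ℝ) < N + 1 / 2 := by positivity
  refine ⟨Real.log (N + 1 / 2), ?_, fun n hn => ?_⟩
  · -- `B ≤ log (N + 1/2)` since `e^B ≤ N ≤ N + 1/2`
    rw [Real.le_log_iff_exp_le hM]
    linarith
  · have hn0 : (0 : ℝ) < n := Nat.cast_pos.mpr (by omega)
    -- the left-hand side is `r / (N + 1/2)²`
    have hexp : Real.exp (-2 * Real.log ((N : ℝ) + 1 / 2)) =
        (((N : ℝ) + 1 / 2) * ((N : ℝ) + 1 / 2))⁻¹ := by
      rw [show -2 * Real.log ((N : ℝ) + 1 / 2) =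
          -(Real.log ((N : ℝ) + 1 / 2) + Real.log ((N : ℝ) + 1 / 2)) by ring,
        Real.exp_neg, Real.exp_add, Real.exp_log hM]
    -- Step 1: `r e^{-2a} ≤ 1/(2N + 2)` because `N ≥ 4r + 2`.
    have h1 : r * Real.exp (-2 * Real.log ((N : ℝ) + 1 / 2)) ≤ 1 / (2 * N + 2) := by
      rw [hexp, ← div_eq_mul_inv, div_le_div_iff₀ (by positivity) (by positivity)]
      nlinarith [mul_nonneg (Nat.cast_nonneg N) (sub_nonneg.mpr hNr),
        mul_nonneg hr.le (Nat.cast_nonneg N)]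
    -- Step 2: `1/(2N + 2) ≤ |a - log n|`, according as `n ≤ N` or `N + 1 ≤ n`.
    have h2 : 1 / (2 * (N : ℝ) + 2) ≤ |Real.log ((N : ℝ) + 1 / 2) - Real.log n| := by
      rcases le_or_gt n N with hle | hlt
      · have hle' : (n : ℝ) ≤ N := by exact_mod_cast hle
        calc 1 / (2 * (N : ℝ) + 2) ≤ ((N : ℝ) + 1 / 2 - n) / (N + 1 / 2) := by
              rw [div_le_div_iff₀ (by positivity) hM]
              nlinarith [mul_nonneg (sub_nonneg.mpr hle') (by positivity : (0 : ℝ) ≤ 2 * N + 2)]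
          _ ≤ Real.log ((N : ℝ) + 1 / 2) - Real.log n := sub_div_le_log_sub_log hn0 hM
          _ ≤ |Real.log ((N : ℝ) + 1 / 2) - Real.log n| := le_abs_self _
      · have hlt' : (N : ℝ) + 1 ≤ n := by exact_mod_cast (hlt : N + 1 ≤ n)
        have hmono : Real.log ((N : ℝ) + 1) ≤ Real.log n :=
          Real.log_le_log (by positivity) hlt'
        calc 1 / (2 * (N : ℝ) + 2) ≤ ((N : ℝ) + 1 - (N + 1 / 2)) / (N + 1) := by
              rw [div_le_div_iff₀ (by positivity) (by positivity)]
              nlinarith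
          _ ≤ Real.log ((N : ℝ) + 1) - Real.log ((N : ℝ) + 1 / 2) :=
              sub_div_le_log_sub_log hM (by positivity)
          _ ≤ Real.log n - Real.log ((N : ℝ) + 1 / 2) := by linarith
          _ ≤ |Real.log ((N : ℝ) + 1 / 2) - Real.log n| := by
              rw [abs_sub_comm]
              exact le_abs_self _
    exact h1.trans h2

end Summit.RiemannHypothesis.RiemannHypothesis.Theorems.OddSector
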